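import Literature.MathematicalPhysics.QuantumFieldTheory.Balaban1983to89.B9Cor36GCubeLocLetter
import Literature.MathematicalPhysics.QuantumFieldTheory.Balaban1983to89.B9Cor36BondSandwichTransfer
import Literature.MathematicalPhysics.QuantumFieldTheory.Balaban1983to89.B9Cor36CubeCutoffs

/-!
# `Balaban1983to89.B9Cor36GCubeLocDefectTransfer` — THE DEFECTS `E_□`, `E♯_□` OF THE BOND-SECTOR CUBE LETTER'S LOCAL-INVERSE LAWS AS MEMBER-SIDE SANDWICHES
# `M_{h_□}·R(u)⁻¹·[core]·R(u)·M_{h_□}` OF A CUBE-SIDE OPERATOR, AND THEIR [4]-(2.51) BLOCK MAJORANTS OVER THE MEMBER's BLOCKS TRANSFERRED FROM ONE CUBE-SIDE DATUM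
# EACH — the bond twin of p21's E2-3a `B9Cor36CinvCubeLocDefectTransfer`, via p38's G-F6b-T `hasMajorant_conj_bond_sandwich_decay` (sub-row G-B9-LETTERS, module M5.1b-G
# item 2 «defect majorants `locDefectBY ∕ locDefectTBY`», programme DEFECT-R, FILE D1; design (R) term, NOT in print)

statement-level skeleton of published theorems with citation tags; proofs where landed; nothing here is a claim about the Yang–Mills mass gap

Sources under audit (cell lit-balaban): T. Bałaban, *Propagators for lattice gauge theories in a background field*, Commun. Math. Phys. **99** (1985) 389–434
[`Balaban1985BackgroundPropagators`, "B9"], Cor. 3.6 p. 408 l. 1–14, (3.87)–(3.89) p. 409, p. 409 l. 1–5, p. 410 l. 13–15, (3.105) p. 414, p. 412 l. 31–36; [4] = T. Bałaban,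
*Propagators and renormalization transformations for lattice gauge theories. II*, Commun. Math. Phys. **96** (1984) 223–250 [`Balaban1984PropagatorsII`], (2.51)–(2.55)
p. 232, (2.79)–(2.85) pp. 237–238, (2.36) p. 229.  Unit `lit-balaban-p33` (p33 gen 102); B9 fold owner r06; referee ref-4.

## WHAT IS PRINTED (verbatim up to notation)

p. 409 l. 1–5: «The operators constructed for this sequence, which we denote by G′_□(U), C_□(U) = (Q′(U)G′_□²(U)Q′*(U))⁻¹, G_□(U), satisfy all the inequalities of Theorems
3.1–3.3 correspondingly»; (3.87) p. 409: «G₀ = Σ_□ h_□G_□h_□»; (3.105) p. 414: «Δ_aG₀ = I − Σ_□K(h_□)G_□h_□ − Σ_□(1 − ζ_□̃)DPD*h_□G_□h_□ − Σ_□ζ_□̃(DPD* − DP_□D*)h_□G_□h_□ −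
Σ_□ζ_□̃P_{□,1}(∂h_□)G_□h_□ = I − R» (which uses `(Δ_loc − DP_□D*)G_□h_□ = h_□`); p. 412 l. 31–36: «… can be estimated by the usual factors multiplied by e^{−2δ₀M}. We have
to notice only that the operators may differ outside □̃₀, and the distance from □̃ to □̃₀ is at least M»; [4] p. 232 (2.51)–(2.52): «|(Tλ)(x)| ≦ K(y,y′)|λ|», «this property
is preserved under the composition of operators possessing it».

## WHY THIS FILE

M5.7's consumer `B9Thm310DeltaAIsUnitOfExpansion.eBlock_kernelFamilyBInv_GAY_of_localInverseCubes''` displays, besides the per-cube (3.42) block `hE` (landed for the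
design-(R) letter `O_□ = M_χR(u)⁻¹G_□(Ṽ_□)R(u)M_χ`: G-F6b ∕ F-F `eBlock_locLetterBY'`), the remainder families `hrest`, `hV'`, whose fourth summands are the DEFECTS of the two
local-inverse laws (G-F2 `B9Cor36GCubeLocLetter`): `E_□ = R(u)⁻¹·M_h·DP_□D*(Ṽ)·(M_χ − 1)·G_□(Ṽ)·R(u)·M_χ·M_h` (`locDefectBY`) and `E♯_□ = M_h·R(u)⁻¹·G_□(Ṽ)·(M_χ − 1)·
DP_□D*(Ṽ)·M_h·R(u)` (`locDefectTBY`) — (R)-DESIGN TERMS, NOT IN PRINT (`= 0` for print's Dirichlet `G_□`).  Their smallness lives on the CUBE side (rows in `supp h_□`,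
the middle factor supported where `χ_□ ≠ 1`, i.e. `≥ 2S_j` away: print's «multiplied by e^{−2δ₀M}» mechanism, FILE D2); THIS FILE is the bookkeeping that reduces
the member-side majorants the consumer wants to ONE cube-side datum each: §1 writes both defects EXACTLY as sandwiches `M_h ∘ R(u)⁻¹ ∘ [core] ∘ R(u) ∘ M_h` at the
cut-offs of record (`χ_□ = chiY`, `h_□ = hTY`; `M_χ·M_h = M_h` because `χ_□ = 1` on `supp h_□`), §2 transfers a cube-side block majorant of the realified core to
the member's blocks by p38's G-F6b-T `hasMajorant_conj_bond_sandwich_decay` (bi-contractive `u`, `|h_□| ≤ 1`, `supp h_□ ⊂ NearH`).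

## WHAT THIS FILE CERTIFIES (kernel-checked; theorems only; 0 `def`, 0 `def … : Prop`, 0 sorry; standard axioms)

* §1 `chiY_mul_hTY` (`χ_□·h_□ = h_□`), `nearH_of_hTY_ne_zero`, `abs_hBdY_hTY_le_one`; ★ `locDefectBY_chiY_hTY_eq_sandwich`, ★ `locDefectTBY_chiY_hTY_eq_sandwich` — the two
  defects at the cut-offs of record as `M_h·R(u)⁻¹·[DP_□D*(Ṽ)(M_χ − 1)G_□(Ṽ)]·R(u)·M_h`, `M_h·R(u)⁻¹·[G_□(Ṽ)(M_χ − 1)DP_□D*(Ṽ)]·R(u)·M_h` (realified, G-F6b-T's shape).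
* §2 `abs_hBdY_hTY_le_indicator`; ★★ `hasMajorant_conj_locDefectBY_of_core`, ★★ `hasMajorant_conj_locDefectTBY_of_core` — for any background `Ṽ`, any gauge `u` with
  `‖u‖, ‖u⁻¹‖ ≤ 1`: a cube-side majorant `conj b([core]) ≺ K_C` over `(toB6 (geoCK i □) Rr H, blkBK i □)` and a member kernel `K ≥ 0` dominating `K_C` on (output block
  meeting `supp h_□`) × (source in `supp h_□`) give `conj b(E_□) ≺ (M₂Σ‖b‖)²·K` (resp. `E♯_□`) over the member's `(toB6 (geo9K i) Rr′ Hp, ιB∘blkV1)` — the ROWS AND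
  COLUMNS THAT MATTER are those within `S_j` of the centre, where FILE D2's separated-product smallness lives; `hasMajorant_conj_locDefectBY_of_core_decay` = the uniform
  decay-shape corollary (`K_C = B·(len a)ⁿ·e^{−δd}`).  The cover sum `Σ_□` into `hrest`∕`hV'`'s 4th families and `hV'`'s source weight are FILE D3.

## HONEST SCOPE

Finite operator algebra + [4] (2.51) bookkeeping over landed modules (G-F2 letters, G-F6b-T transfer, p33 `B9Cor36CubeCutoffs`); the cube-side data `hD`, `hDT` are
HYPOTHESES (FILE D2: [4] (2.83)–(2.85) separated products; their input `DP_□D*(Ṽ_□) ≺ K(len a²)⁻¹e^{−δd}` is asked by name on HOME/INBOX 2026-08-28).  (R)-design terms,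
NOT in print.  Inhabited: at `Ṽ` with `χ_□ ≡ 1` near the rows the core vanishes — not a vacuous schema (`B := 0` is allowed).  Count-neutral; NOT a node discharge; no
summit ∕ sub-problem statement is proved; nothing continuum ∕ OS ∕ mass-gap ∕ Clay; YM mass gap NOT proved by any of this (Track A conditional rung).  No `sorry`, no
`axiom`, no `… : Prop` fact, no `instance`, no `notation`.  NEW file; nothing landed is modified.  `--supports stmt-QuantumFields-19200`.  Net new unproved facts: 0.

RELATED IN THE TREE, NOT DUPLICATED (searched 2026-08-28: `rg 'locDefect'` = G-F2, G-F3, G-F6b, F-F, L-ASM (docstrings) only; `rg 'hasMajorant.*DPDs'` = ∅): p21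
`B9Cor36CinvCubeLocDefectTransfer` (C-letter, block carriers with bridge maps — a different carrier), p38 `B9Cor36BondSandwichTransfer` (USED BY NAME).
-/

noncomputable section

namespace Literature.MathematicalPhysics.QuantumFieldTheory.Balaban1983to89.B9Cor36GCubeLocDefectTransfer

open B6RandomWalk (HasMajorant hasMajorant_mono)
open B9Thm34Ext (toB6)
open B9Eq352DivFormLetters (conj)
open B9Eq39Adjoint (R)
open B9Eq310Hermitian (norm_R_le norm_R_inv_le)
open B6KLevelCensusIndexV1 (KIdx)
open B6Cover236MultiLevelBlocks (cubes)
open B6GlobalChartV1 (blkV1)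
open B6Geom246MultiLevelBox (blkOf)
open B6Ineq2142KLevelV1 (β)
open B9GeoNormsKLevelV1 (geo9K)
open B9Thm37CubeCoverCommutators (cutMulY cutMulY_apply hTY hTY_apply)
open B9Eq3104CutoffCommutators (hBdY hBdY_apply)
open B9Eq3105AtLetters (DPDsCubeY)
open B9CubeLettersBondOpsL0 (BlkCubeY GACubeY)
open B9Eq360DeltaPrimeACubeY (blkCubeY)
open B9CubeGeometryInputs (geoCK geoCK_len_pos)
open B9CubeSequence408 (NearH)
open B9Cor35GCubeInputsAtOne (blkBK)
open B9Cor36CubeCutoffs (SC chiY chiY_eq_one_of_nearC nearC_of_hT_ne_zero nearH_of_nearC)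
open B9Cor36GCubeLocLetter (locDefectBY locDefectTBY cutMulY_mul_conjY_eq cutMulY_hBdY_mul_of_eq cutMulY_hBdY_mul_of_eq')
open B9Cor36BondSandwichTransfer (hasMajorant_conj_bond_sandwich hasMajorant_conj_bond_sandwich_decay)
open Node00 (SiteY BlkY IBondY FBondY CfgY GaugeY SiteParY BondParY toKT conjY gBondY)
open Node00.OpsYNablaBridge (chartY)

variable {d ℓ : ℕ} {hd : 1 ≤ d + 1} {hL : Odd (ℓ + 1) ∧ 1 < ℓ + 1} {b₀ b₁ : ℝ}
variable {𝔸 : Type} [NormedRing 𝔸] [NormedAlgebra ℂ 𝔸] [CompleteSpace 𝔸]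
variable {ι : Type} [Fintype ι]

/-! ## §1  The two defects at the cut-offs of record as sandwiches `M_h ∘ R(u)⁻¹ ∘ [core] ∘ R(u) ∘ M_h` -/

section Identity

variable (i : KIdx d ℓ hd hL b₀ b₁) (c : ↥(cubes (toKT i).D.toDomains)) (parS : SiteParY 𝔸 i) (parB : BondParY 𝔸 i)

/-- `χ_□·h_□ = h_□`: the plateau of `χ_□ = chiY i □` (`= 1` within `3S_j` of the centre) contains `supp h_□ ⊂ {≤ S_j}` (p33 `chiY_eq_one_of_nearC`, `nearC_of_hT_ne_zero`).
[cite: Balaban1985BackgroundPropagators, (3.87) p.409, p.415 («ζ_□̃h_□ = h_□»); Balaban1984PropagatorsII, (2.36) p.229] -/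
theorem chiY_mul_hTY (z : SiteY i) : chiY i c z * hTY i c z = hTY i c z := by
  by_cases h : hTY i c z = 0
  · rw [h, mul_zero]
  · rw [chiY_eq_one_of_nearC i c (by have := B9Cor36CubeCutoffs.one_le_SC i c; omega) (nearC_of_hT_ne_zero i c h), one_mul]

/-- `supp h_□ ⊂ NearH □` (within `S_j ≤ 3S_j` of the centre). [cite: Balaban1985BackgroundPropagators, (3.87)–(3.88) p.409; Balaban1984PropagatorsII, (2.36) p.229] -/
theorem nearH_of_hTY_ne_zero {z : SiteY i} (h : hTY i c z ≠ 0) : NearH c z.1 :=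
  nearH_of_nearC i c (by have := B9Cor36CubeCutoffs.one_le_SC i c; omega) (nearC_of_hT_ne_zero i c h)

/-- `|h_□(f₋)| ≤ 1` (`0 ≤ h_□ ≤ 1`). [cite: Balaban1984PropagatorsII, (2.36) p.229; Balaban1985BackgroundPropagators, p.408] -/
theorem abs_hBdY_hTY_le_one (f : FBondY i) : |hBdY i (hTY i c) f| ≤ 1 := by
  rw [hBdY_apply, hTY_apply]
  exact B6Partition118KLevelTorus.abs_hT_le_one (D := i.D) (toKT i).hMh (toKT i).hP c _

/-- ★ **`E_□` AS A SANDWICH**: `E_□ = M_h ∘ R(u)⁻¹ ∘ [DP_□D*(Ṽ)∘(M_χ − 1)∘G_□(Ṽ)] ∘ R(u) ∘ M_h` at `χ = χ_□`, `h = h_□` (realified; `R(u)⁻¹M_h = M_hR(u)⁻¹`, `M_χM_h = M_h`).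
[cite: Balaban1985BackgroundPropagators, (3.105) p.414, (3.34) p.396, p.409 l.3–5; Balaban1984PropagatorsII, (2.79)–(2.82) p.237] -/
theorem locDefectBY_chiY_hTY_eq_sandwich (g : GaugeY 𝔸 i) (V : CfgY 𝔸 i) :
    (locDefectBY i c parS parB g (chiY i c) (hTY i c) V).restrictScalars ℝ =
      (cutMulY (𝔸 := 𝔸) (hBdY i (hTY i c))).restrictScalars ℝ ∘ₗ (conjY (gBondY i g)⁻¹).restrictScalars ℝ ∘ₗ
        ((DPDsCubeY i c parS V * (cutMulY (hBdY i (chiY i c)) - 1) * GACubeY i c parS parB V).restrictScalars ℝ) ∘ₗ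
        (conjY (gBondY i g)).restrictScalars ℝ ∘ₗ (cutMulY (𝔸 := 𝔸) (hBdY i (hTY i c))).restrictScalars ℝ := by
  have e : locDefectBY i c parS parB g (chiY i c) (hTY i c) V =
      cutMulY (hBdY i (hTY i c)) * conjY (gBondY i g)⁻¹ * (DPDsCubeY i c parS V * (cutMulY (hBdY i (chiY i c)) - 1) * GACubeY i c parS parB V) *
        conjY (gBondY i g) * cutMulY (hBdY i (hTY i c)) := by
    rw [locDefectBY, ← cutMulY_mul_conjY_eq (gBondY i g)⁻¹ (hBdY i (hTY i c)), mul_assoc _ (cutMulY (hBdY i (chiY i c))) (cutMulY (hBdY i (hTY i c))),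
      cutMulY_hBdY_mul_of_eq i (chiY i c) (hTY i c) (chiY_mul_hTY i c)]
    simp only [mul_assoc]
  rw [e]
  exact LinearMap.ext fun _ => rfl

/-- ★ **`E♯_□` AS A SANDWICH**: `E♯_□ = M_h ∘ R(u)⁻¹ ∘ [G_□(Ṽ)∘(M_χ − 1)∘DP_□D*(Ṽ)] ∘ R(u) ∘ M_h` (`M_hR(u) = R(u)M_h`).
[cite: Balaban1985BackgroundPropagators, (3.105) p.414, (3.34) p.396, p.409 l.3–5; Balaban1984PropagatorsII, (2.79)–(2.82) p.237] -/
theorem locDefectTBY_chiY_hTY_eq_sandwich (g : GaugeY 𝔸 i) (V : CfgY 𝔸 i) :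
    (locDefectTBY i c parS parB g (chiY i c) (hTY i c) V).restrictScalars ℝ =
      (cutMulY (𝔸 := 𝔸) (hBdY i (hTY i c))).restrictScalars ℝ ∘ₗ (conjY (gBondY i g)⁻¹).restrictScalars ℝ ∘ₗ
        ((GACubeY i c parS parB V * (cutMulY (hBdY i (chiY i c)) - 1) * DPDsCubeY i c parS V).restrictScalars ℝ) ∘ₗ
        (conjY (gBondY i g)).restrictScalars ℝ ∘ₗ (cutMulY (𝔸 := 𝔸) (hBdY i (hTY i c))).restrictScalars ℝ := by
  have e : locDefectTBY i c parS parB g (chiY i c) (hTY i c) V =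
      cutMulY (hBdY i (hTY i c)) * conjY (gBondY i g)⁻¹ * (GACubeY i c parS parB V * (cutMulY (hBdY i (chiY i c)) - 1) * DPDsCubeY i c parS V) *
        conjY (gBondY i g) * cutMulY (hBdY i (hTY i c)) := by
    rw [locDefectTBY, mul_assoc _ (cutMulY (hBdY i (hTY i c))) (conjY (gBondY i g)), cutMulY_mul_conjY_eq (gBondY i g) (hBdY i (hTY i c))]
    simp only [mul_assoc]
  rw [e]
  exact LinearMap.ext fun _ => rfl

end Identity

/-! ## §2  The member-side majorants from one cube-side datum each (rows that matter: the blocks meeting `supp h_□`) -/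

section Majorant

variable (i : KIdx d ℓ hd hL b₀ b₁) (c : ↥(cubes (toKT i).D.toDomains)) (parS : SiteParY 𝔸 i) (parB : BondParY 𝔸 i) (b : Module.Basis ι ℝ 𝔸)

open Classical in
/-- the ROW INDICATOR of the cube blocks meeting `supp h_□` dominates `|h_□(f₋)|` blockwise. [cite: Balaban1984PropagatorsII, (2.36) p.229, (2.79)–(2.82) p.237, bookkeeping] -/
theorem abs_hBdY_hTY_le_indicator (f : FBondY i) :
    |hBdY i (hTY i c) f| ≤ (if ∃ z : SiteY i, blkCubeY i c z = blkCubeY i c (chartY i f.src) ∧ hTY i c z ≠ 0 then (1 : ℝ) else 0) := by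
  by_cases h : hTY i c (chartY i f.src) = 0
  · rw [hBdY_apply, h, abs_zero]; split_ifs <;> norm_num
  · rw [if_pos ⟨chartY i f.src, rfl, h⟩]; exact abs_hBdY_hTY_le_one i c f

open Classical in
/-- ★★ **THE MEMBER-SIDE MAJORANT OF `E_□` FROM ONE CUBE-SIDE DATUM**: if the realified core `DP_□D*(Ṽ)∘(M_{χ_□} − 1)∘G_□(Ṽ)` has SOME block majorant `K_C` over the cube
sequence's blocks `(toB6 (geoCK i □) Rr H, blkBK i □)`, the gauge `u` is bi-contractive, and a member kernel `K ≥ 0` dominates `K_C` ON THE ROWS AND COLUMNS THAT MATTER —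
output block meeting `supp h_□`, source site in `supp h_□` (both within `S_j` of the centre, where FILE D2's separated-product smallness lives) — then
`conj b(E_□) ≺ (M₂Σ‖b_j‖)²·K` over the member's blocks `(toB6 (geo9K i) Rr′ Hp, ιB∘Δ)`: p38's G-F6b-T transfer at `g₁ = g₂ = h_□` with the row indicator as `G₁`.
[cite: Balaban1985BackgroundPropagators, Cor. 3.6 p.408 l.11–14, (3.105) p.414, p.412 l.31–36; Balaban1984PropagatorsII, (2.51)–(2.55) p.232, (2.82)–(2.85) pp.237–238] -/
theorem hasMajorant_conj_locDefectBY_of_core {M₂ : ℝ} (hM₂ : 0 ≤ M₂) (hrepr : ∀ (v : 𝔸) (j : ι), |b.repr v j| ≤ M₂ * ‖v‖)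
    (g : GaugeY 𝔸 i) (hg : ∀ x, ‖((g x : 𝔸ˣ) : 𝔸)‖ ≤ 1 ∧ ‖(((g x)⁻¹ : 𝔸ˣ) : 𝔸)‖ ≤ 1) (V : CfgY 𝔸 i)
    (ιB : BlkY i → IBondY i) (hι : ∀ s, β i.hN i.D i.hk (ιB s) = s) (Rr : ℝ) (H : Prop) [Fintype (geo9K i).Site] (Rr' : ℝ) (Hp : Prop)
    {KC : BlkCubeY i c → BlkCubeY i c → ℝ} {K : IBondY i → IBondY i → ℝ} (hK : ∀ a a', 0 ≤ K a a')
    (hcmp : ∀ x x₀ : FBondY i, (∃ z : SiteY i, blkCubeY i c z = blkCubeY i c (chartY i x.src) ∧ hTY i c z ≠ 0) → hTY i c (chartY i x₀.src) ≠ 0 →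
      KC (blkCubeY i c (chartY i x.src)) (blkCubeY i c (chartY i x₀.src)) ≤ K (ιB (blkOf i.D.toDomains (chartY i x.src))) (ιB (blkOf i.D.toDomains (chartY i x₀.src))))
    (hD : HasMajorant (g := toB6 (geoCK i c) Rr H) (blkBK i c)
      (conj b ((DPDsCubeY i c parS V * (cutMulY (hBdY i (chiY i c)) - 1) * GACubeY i c parS parB V).restrictScalars ℝ)) KC) :
    HasMajorant (g := toB6 (geo9K i) Rr' Hp) (fun p : FBondY i × ι => ιB (blkV1 i.hN i.D p.1))
      (conj b ((locDefectBY i c parS parB g (chiY i c) (hTY i c) V).restrictScalars ℝ)) (fun a a' => (M₂ * ∑ j, ‖b j‖) ^ 2 * K a a') := by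
  have hγ : ∀ (f : FBondY i) (a : 𝔸), ‖R (gBondY i g f) a‖ ≤ ‖a‖ ∧ ‖R (gBondY i g f)⁻¹ a‖ ≤ ‖a‖ := fun f a =>
    ⟨norm_R_le (hg _).1 (hg _).2 a, norm_R_inv_le (hg _).1 (hg _).2 a⟩
  rw [locDefectBY_chiY_hTY_eq_sandwich]
  refine hasMajorant_conj_bond_sandwich i c b hM₂ hrepr (gBondY i g) hγ (hBdY i (hTY i c)) (hBdY i (hTY i c))
    (fun a => if ∃ z : SiteY i, blkCubeY i c z = a ∧ hTY i c z ≠ 0 then (1 : ℝ) else 0) (fun _ => 1) (abs_hBdY_hTY_le_indicator i c) (abs_hBdY_hTY_le_one i c)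
    (fun f hf => nearH_of_hTY_ne_zero i c (by rw [hBdY_apply] at hf; exact hf)) ιB hι Rr H Rr' Hp hK (fun x x₀ hx₀ => ?_) _ hD
  rw [hBdY_apply] at hx₀
  split_ifs with hx
  · rw [one_mul, mul_one]; exact hcmp x x₀ hx hx₀
  · rw [zero_mul, zero_mul]; exact hK _ _

open Classical in
/-- ★★ **THE MEMBER-SIDE MAJORANT OF `E♯_□` FROM ONE CUBE-SIDE DATUM**: the same for the transposed law's defect, core `G_□(Ṽ)∘(M_{χ_□} − 1)∘DP_□D*(Ṽ)`.
[cite: Balaban1985BackgroundPropagators, Cor. 3.6 p.408 l.11–14, (3.105) p.414, p.412 l.31–36; Balaban1984PropagatorsII, (2.51)–(2.55) p.232, (2.82)–(2.85) pp.237–238] -/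
theorem hasMajorant_conj_locDefectTBY_of_core {M₂ : ℝ} (hM₂ : 0 ≤ M₂) (hrepr : ∀ (v : 𝔸) (j : ι), |b.repr v j| ≤ M₂ * ‖v‖)
    (g : GaugeY 𝔸 i) (hg : ∀ x, ‖((g x : 𝔸ˣ) : 𝔸)‖ ≤ 1 ∧ ‖(((g x)⁻¹ : 𝔸ˣ) : 𝔸)‖ ≤ 1) (V : CfgY 𝔸 i)
    (ιB : BlkY i → IBondY i) (hι : ∀ s, β i.hN i.D i.hk (ιB s) = s) (Rr : ℝ) (H : Prop) [Fintype (geo9K i).Site] (Rr' : ℝ) (Hp : Prop)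
    {KC : BlkCubeY i c → BlkCubeY i c → ℝ} {K : IBondY i → IBondY i → ℝ} (hK : ∀ a a', 0 ≤ K a a')
    (hcmp : ∀ x x₀ : FBondY i, (∃ z : SiteY i, blkCubeY i c z = blkCubeY i c (chartY i x.src) ∧ hTY i c z ≠ 0) → hTY i c (chartY i x₀.src) ≠ 0 →
      KC (blkCubeY i c (chartY i x.src)) (blkCubeY i c (chartY i x₀.src)) ≤ K (ιB (blkOf i.D.toDomains (chartY i x.src))) (ιB (blkOf i.D.toDomains (chartY i x₀.src))))
    (hDT : HasMajorant (g := toB6 (geoCK i c) Rr H) (blkBK i c)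
      (conj b ((GACubeY i c parS parB V * (cutMulY (hBdY i (chiY i c)) - 1) * DPDsCubeY i c parS V).restrictScalars ℝ)) KC) :
    HasMajorant (g := toB6 (geo9K i) Rr' Hp) (fun p : FBondY i × ι => ιB (blkV1 i.hN i.D p.1))
      (conj b ((locDefectTBY i c parS parB g (chiY i c) (hTY i c) V).restrictScalars ℝ)) (fun a a' => (M₂ * ∑ j, ‖b j‖) ^ 2 * K a a') := by
  have hγ : ∀ (f : FBondY i) (a : 𝔸), ‖R (gBondY i g f) a‖ ≤ ‖a‖ ∧ ‖R (gBondY i g f)⁻¹ a‖ ≤ ‖a‖ := fun f a =>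
    ⟨norm_R_le (hg _).1 (hg _).2 a, norm_R_inv_le (hg _).1 (hg _).2 a⟩
  rw [locDefectTBY_chiY_hTY_eq_sandwich]
  refine hasMajorant_conj_bond_sandwich i c b hM₂ hrepr (gBondY i g) hγ (hBdY i (hTY i c)) (hBdY i (hTY i c))
    (fun a => if ∃ z : SiteY i, blkCubeY i c z = a ∧ hTY i c z ≠ 0 then (1 : ℝ) else 0) (fun _ => 1) (abs_hBdY_hTY_le_indicator i c) (abs_hBdY_hTY_le_one i c)
    (fun f hf => nearH_of_hTY_ne_zero i c (by rw [hBdY_apply] at hf; exact hf)) ιB hι Rr H Rr' Hp hK (fun x x₀ hx₀ => ?_) _ hDT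
  rw [hBdY_apply] at hx₀
  split_ifs with hx
  · rw [one_mul, mul_one]; exact hcmp x x₀ hx hx₀
  · rw [zero_mul, zero_mul]; exact hK _ _

/-- ★★ **THE DECAY SHAPE** (a corollary for a uniform cube-side kernel): `conj b([core]) ≺ B·(len a)ⁿ·e^{−δd}` over the cube blocks ⟹ `conj b(E_□) ≺ (M₂Σ‖b‖)²·B·(len a)ⁿ·e^{−δd}`
over the member blocks (p38's `hasMajorant_conj_bond_sandwich_decay`, `m = 0`; a uniform `B` does not carry FILE D2's smallness — use the indicator form above for that).
[cite: Balaban1985BackgroundPropagators, Cor. 3.6 p.408 l.11–14, (3.105) p.414; Balaban1984PropagatorsII, (2.51)–(2.55) p.232] -/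
theorem hasMajorant_conj_locDefectBY_of_core_decay {M₂ : ℝ} (hM₂ : 0 ≤ M₂) (hrepr : ∀ (v : 𝔸) (j : ι), |b.repr v j| ≤ M₂ * ‖v‖)
    (g : GaugeY 𝔸 i) (hg : ∀ x, ‖((g x : 𝔸ˣ) : 𝔸)‖ ≤ 1 ∧ ‖(((g x)⁻¹ : 𝔸ˣ) : 𝔸)‖ ≤ 1) (V : CfgY 𝔸 i)
    (ιB : BlkY i → IBondY i) (hι : ∀ s, β i.hN i.D i.hk (ιB s) = s) (Rr : ℝ) (H : Prop) [Fintype (geo9K i).Site] (Rr' : ℝ) (Hp : Prop)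
    {B δ : ℝ} (hB : 0 ≤ B) (hδ : 0 ≤ δ) (n : ℕ)
    (hD : HasMajorant (g := toB6 (geoCK i c) Rr H) (blkBK i c)
      (conj b ((DPDsCubeY i c parS V * (cutMulY (hBdY i (chiY i c)) - 1) * GACubeY i c parS parB V).restrictScalars ℝ))
      (fun a a' => B * (geoCK i c).len a ^ n * Real.exp (-(δ * (geoCK i c).dist a a')))) :
    HasMajorant (g := toB6 (geo9K i) Rr' Hp) (fun p : FBondY i × ι => ιB (blkV1 i.hN i.D p.1))
      (conj b ((locDefectBY i c parS parB g (chiY i c) (hTY i c) V).restrictScalars ℝ))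
      (fun a a' => (M₂ * ∑ j, ‖b j‖) ^ 2 * B * (geo9K i).len a ^ n * Real.exp (-(δ * (geo9K i).dist a a'))) := by
  have hγ : ∀ (f : FBondY i) (a : 𝔸), ‖R (gBondY i g f) a‖ ≤ ‖a‖ ∧ ‖R (gBondY i g f)⁻¹ a‖ ≤ ‖a‖ := fun f a =>
    ⟨norm_R_le (hg _).1 (hg _).2 a, norm_R_inv_le (hg _).1 (hg _).2 a⟩
  rw [locDefectBY_chiY_hTY_eq_sandwich]
  refine hasMajorant_mono (g := toB6 (geo9K i) Rr' Hp) _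
    (hasMajorant_conj_bond_sandwich_decay i c b hM₂ hrepr (gBondY i g) hγ (hBdY i (hTY i c)) (hBdY i (hTY i c)) zero_le_one zero_le_one (Nat.zero_le n)
      (fun f => by rw [pow_zero, mul_one]; exact abs_hBdY_hTY_le_one i c f) (abs_hBdY_hTY_le_one i c)
      (fun f hf => nearH_of_hTY_ne_zero i c (by rw [hBdY_apply] at hf; exact hf)) ιB hι Rr H Rr' Hp hB hδ _ hD) fun a a' => le_of_eq ?_
  rw [Nat.sub_zero]; ring

end Majorant

end Literature.MathematicalPhysics.QuantumFieldTheory.Balaban1983to89.B9Cor36GCubeLocDefectTransfer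

end
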